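import Literature.MathematicalPhysics.QuantumFieldTheory.Balaban1983to89.B6
import Literature.MathematicalPhysics.QuantumFieldTheory.Balaban1983to89.B6TreeGaugePoincare

/-!
# `Balaban1983to89.B6Lemma24Carrier` — the CONCRETE carrier of Lemma 2.4 on the unit lattice, with the
# step (2.123) DISCHARGED: `B6.Step2123` is a theorem for it, so Lemma 2.4_κ follows from (2.127)_κ alone

T. Bałaban, *Propagators for lattice gauge theories in a background field. II*, Commun. Math. Phys. **96**,
223–250 (1984) [Balaban1984PropagatorsII] (cell paper B6): Lemma 2.4 p. 245 [PDF 23], (2.121)/(2.123)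
p. 244 [PDF 22], (2.124)–(2.128) p. 245.  Renders `1984-cmp96-propagators-rt-II-p022-x2.png` (p. 244) and
`…-p023-x2.png` (p. 245) read as images by this seat.

CITATION HEADER (lean-in-tree rule 2026-08-18).  PRINTED, p. 245, verbatim: *"The inequalities (2.123) and
(2.127) imply many other inequalities. One of them is formulated in Lemma 2.4. Let a set Λ ⊂ Z^d be a sum of
blocks, Λ = B(Λ′). We denote by Λ also a set of bonds b such that at least one of the end-points b₋, b₊
belongs to Λ. Let B be a configuration defined on Λ and satisfying the condition (2.121): B(Γ_{y,x}) = 0 for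
x ∈ B(y), y ∈ Λ′. We put B = 0 outside Λ. Then the following inequality holds
L^{d−2} Σ_{c∈Λ′} |(Q₁B)(c)|² + Σ_p |(∂₁B)(p)|² ≥ (1/(12d²)) L^{−d−1} ‖B‖². (2.128)"*; p. 244 (2.123), verbatim:
*"Σ_{b⊂B(y)} |B(b)|² ≤ dL^d Σ_{p⊂B(y)} |(∂₁B)(p)|²."*; p. 245 (2.125), first equality, verbatim:
*"|(Q₁B)(c)|² = |Σ_{x∈B(c₋)} L^{−(d+1)}B([x, x + Le_μ])|²"*.

WHAT THE CELL ALREADY HAS (imported, untouched).  `B6.lean` (b06, T03.5) types Lemma 2.4 over an ABSTRACT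
carrier: `B6.TreeData` (Cfg, TreeGauge, q1Sq, d1Sq, normSq), its refinement `B6.SplitData` (‖B‖² = N_in + N_cr,
Σ_p|∂₁B|² ≥ P_in + P_cr), the two printed steps as HYPOTHESES `B6.Step2123` ((2.123) summed over the blocks:
L^{−d}N_in ≤ d·P_in) and `B6.Step2127` ((2.127)_κ summed), and the kernel-checked assembly
`B6.lemma24K_of_steps : Step2123 → Step2127_κ → Lemma24K_κ` (d ≥ 2, L ≥ 1, κ ≤ 1; census G-B6-08), with
`B6.Lemma24Repaired` = κ_L (G-B6-10) and `B6.ineq2127_fails_L10` (the printed κ = 1 step is false, G-B6-09R).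
`B6TreeGaugePoincare.lean` (pv09-g4, p180227/p180400) PROVES (2.123) on the concrete unit lattice:
`ineq2123_rescaled : (L⁻¹)^d Σ_{y∈Y} Σ_{b⊂B(y)} |B(b)|² ≤ d Σ_{y∈Y} Σ_{p⊂B(y)} |(∂₁B)(p)|²` under the tree gauge
(2.121) in every block B(y), y ∈ Y.

THIS FILE (journal node G-B6-L24-CARRIER-KERNEL of the cell `pub-balaban`) joins the two: it builds the CONCRETE
carrier of Lemma 2.4 as a `B6.TreeData` + `B6.SplitData` and proves `B6.Step2123` for it, so that for this
carrier the abstract assembly needs only the (2.127)_κ hypothesis: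
* §1 the region: `lam L Λ′ = ⋃_{y∈Λ′} B(y)` (`B6Elimination.block`, B5 (1.6)) for a finite set Λ′ of L-LATTICE
  points (hypothesis `∀ y ∈ Λ′, ∀ i, L ∣ y_i` wherever disjointness of the blocks is used); `lamBonds` = the printed
  *"set of bonds b such that at least one of the end-points b₋, b₊ belongs to Λ"* (`mem_lamBonds`); `lamPlaq` =
  the plaquettes (z, j, μ), j < μ, whose lowest corner z lies in ⋃_{y∈Λ′} [y − 1, y + L)^d — every plaquette
  with a corner in Λ is among them, and a configuration vanishing off `lamBonds` has zero circulation around every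
  other plaquette (`curl_eq_zero_off`), so `Σ_{p ∈ lamPlaq} |(∂₁B)(p)|²` IS the printed `Σ_p |(∂₁B)(p)|²` over all
  plaquettes of Z^d once *"B = 0 outside Λ"*;
* §2 disjointness of the blocks at distinct L-lattice points (`eq_of_mem_block`) and the two inclusions
  N_in ≤ ‖B‖² (`nIn_le_normSq`), P_in ≤ Σ_p|∂₁B|² (`pIn_le_d1Sq`), N_in / P_in being the literal block sums of
  `B6TreeGaugePoincare` (`innerBonds`, `innerPlaq`, `curl`);
* §3 the carrier `carrier L Λ′ q1 : B6.TreeData` — Cfg = `B6TreeGaugePoincare.Cfg d` (real functions on the unit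
  bonds ⟨z, z + e_μ⟩ of Z^d), TreeGauge B = (*"B = 0 outside Λ"*: B b = 0 for b ∉ lamBonds) ∧ ((2.121) in every
  block: B b = 0 for b ∈ `B6BondElimination.treeBonds L y`, y ∈ Λ′ — the bonds of the contours Γ_{y,x}, B5 (1.7),
  fidelity `B6BondElimination.isTree_iff` / `axial_iff`), normSq B = Σ_{b ∈ lamBonds} |B(b)|² (= ‖B‖²),
  d1Sq B = Σ_{p ∈ lamPlaq} |(∂₁B)(p)|², q1Sq = a PARAMETER `q1 : Cfg d → ℝ` (see HONEST SCOPE (i)); and the split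
  `split … : B6.SplitData (carrier L Λ′ q1)` with N_in, P_in the block sums, N_cr := ‖B‖² − N_in (the bonds of Λ
  joining two blocks or leaving Λ — exactly the docstring of `B6.SplitData`), P_cr := Σ_p|∂₁B|² − P_in (ALL
  non-inner plaquettes; see (ii));
* §4 **`step2123`**: `B6.Step2123 d L (carrier L Λ′ q1) (split …)` — PROVED (one line from `ineq2123_rescaled`);
  **`lemma24K_of_step2127`** / **`lemma24Repaired_of_step2127`**: for every family of such carriers (any index
  type, d ≥ 2, L ≥ 1, κ ≤ 1 resp. κ = κ_L) the summed (2.127)_κ hypothesis `B6.Step2127` ALONE gives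
  `B6.Lemma24K` resp. `B6.Lemma24Repaired` — by `B6.lemma24K_of_steps` with its (2.123) slot filled by `step2123`;
* §5 the printed Q₁-term as an optional instance of the parameter: `q1Of L Λ′ B = Σ_{c} |Σ_{x∈B(c₋)} L^{−(d+1)}
  B([x, x + Le_μ])|²` over the coarse bonds c = ⟨y, y + Le_μ⟩ meeting Λ′ ((2.125) first equality, transcribed;
  `q1Of_nonneg`), so `carrier L Λ′ (q1Of L Λ′)` is available with no parameter left.

DICTIONARY / HONEST SCOPE.  (i) Q₁ is NOT re-derived here: B5 (1.8) defines the averaging Q on bond variables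
through contours, and (2.125) prints its tree-gauge form on the unit lattice; the theorems of §4 hold for EVERY
functional q1 ≥ 0, and §5 merely transcribes the printed (2.125) expression for consumers — whether it equals
B5 (1.8)'s Q₁ under (2.121) is not asserted.  (ii) P_cr here is the sum over ALL plaquettes of `lamPlaq` not
inside a single block, a superset of the printed families *"p ⊂ B(c)"* of (2.124) (which are pairwise disjoint and
never inside one block); hence the hypothesis `B6.Step2127` for THIS split (right side 3(L^{−d}P_cr + Σ|Q₁B|²)) is
implied by, and weaker than, the literal sum over c ∈ Λ′ of (2.127)_κ — the file does not prove that comparison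
and does not touch (2.124)–(2.127) at all ((2.127) as printed is false for L ≥ 10, `B6.ineq2127_fails_L10`; the
repaired (2.127)_{κ_L} is proved in prose only, census G-B6-09R/G-B6-10).  (iii) Λ′ ⊂ LZ^d is imposed as the
hypothesis `∀ y ∈ Λ′, ∀ i, (L:ℤ) ∣ y i` (the print's Λ′ is a set of points of the L-lattice; B5 (1.6)); d, L are
otherwise arbitrary in §§1–3 (L ≥ 1), d ≥ 2 enters only through `B6.lemma24K_of_steps`.  (iv) Nothing printed is
asserted as a hypothesis-free fact beyond what is proved: the only remaining hypothesis of the corollaries is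
`B6.Step2127` (the (2.127)_κ step).  Value = kernel discharge of the (2.123) slot of the cell's Lemma 2.4 assembly
on the honest carrier, NOT summit progress.  Unit b2b-balaban-pv09-g4 (surge node prover #09 gen 4); staged
byte-identically under `HOME/lean/BalabanYm4/`.
-/

open Finset

namespace Literature.MathematicalPhysics.QuantumFieldTheory.Balaban1983to89.B6Lemma24Carrier

open B6Elimination (block mem_block corner corner_eq_self_of_dvd mem_block_corner_iff)
open B6BondElimination (unitVec unitVec_apply add_unitVec_apply treeBonds mem_treeBonds)
open B6TreeGaugePoincare (Cfg curl innerBonds innerPlaq mem_innerBonds mem_innerPlaq ineq2123_rescaled)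
open B6 (TreeData SplitData Step2123 Step2127 Lemma24K Lemma24Repaired kappaL kappaL_le_one lemma24K_of_steps)

noncomputable section

variable {d : ℕ} {L : ℕ}

/-! ## §1  The region Λ = B(Λ′), the bonds meeting Λ, the plaquettes near Λ -/

/-- Λ = B(Λ′) = ⋃_{y∈Λ′} B(y) (*"Let a set Λ ⊂ Z^d be a sum of blocks, Λ = B(Λ′)"*), B(y) = `B6Elimination.block L y`
= B5 (1.6). [cite: Balaban1984PropagatorsII, Lemma 2.4 p.245] -/
def lam (L : ℕ) (Λ' : Finset (Fin d → ℤ)) : Finset (Fin d → ℤ) := Λ'.biUnion (block L)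

/-- x ∈ Λ iff x lies in one of the blocks B(y), y ∈ Λ′. [folklore] -/
theorem mem_lam {Λ' : Finset (Fin d → ℤ)} {x : Fin d → ℤ} : x ∈ lam L Λ' ↔ ∃ y ∈ Λ', x ∈ block L y := by
  simp only [lam, mem_biUnion]

/-- The bonds of Λ (*"We denote by Λ also a set of bonds b such that at least one of the end-points b₋, b₊
belongs to Λ"*): unit bonds ⟨z, z + e_μ⟩, encoded (z, μ), with z ∈ Λ or z + e_μ ∈ Λ (`mem_lamBonds`).
[cite: Balaban1984PropagatorsII, Lemma 2.4 p.245] -/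
def lamBonds (L : ℕ) (Λ' : Finset (Fin d → ℤ)) : Finset ((Fin d → ℤ) × Fin d) :=
  (lam L Λ' ×ˢ (univ : Finset (Fin d))) ∪
    ((lam L Λ' ×ˢ (univ : Finset (Fin d))).image fun b => (b.1 - unitVec b.2, b.2))

/-- Fidelity: b = ⟨z, z + e_μ⟩ is a bond of Λ iff at least one of its end points lies in Λ. [folklore] -/
theorem mem_lamBonds {Λ' : Finset (Fin d → ℤ)} {b : (Fin d → ℤ) × Fin d} :
    b ∈ lamBonds L Λ' ↔ b.1 ∈ lam L Λ' ∨ b.1 + unitVec b.2 ∈ lam L Λ' := by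
  constructor
  · intro h
    rcases mem_union.1 h with h | h
    · exact Or.inl (mem_product.1 h).1
    · obtain ⟨b', hb', rfl⟩ := mem_image.1 h
      refine Or.inr ?_
      show b'.1 - unitVec b'.2 + unitVec b'.2 ∈ lam L Λ'
      rw [sub_add_cancel]
      exact (mem_product.1 hb').1
  · rintro (h | h)
    · exact mem_union.2 (Or.inl (mem_product.2 ⟨h, mem_univ _⟩))
    · refine mem_union.2 (Or.inr (mem_image.2 ⟨(b.1 + unitVec b.2, b.2), mem_product.2 ⟨h, mem_univ _⟩, ?_⟩))
      show (b.1 + unitVec b.2 - unitVec b.2, b.2) = b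
      rw [add_sub_cancel_right]

/-- Lowest corners of the plaquettes that can meet Λ: ⋃_{y∈Λ′} [y − 1, y + L)^d. [folklore] -/
def lamPlaqBase (L : ℕ) (Λ' : Finset (Fin d → ℤ)) : Finset (Fin d → ℤ) :=
  Λ'.biUnion fun y => Fintype.piFinset fun i => Ico (y i - 1) (y i + L)

/-- The plaquettes near Λ, each recorded once as (z, j, μ): lowest corner z ∈ `lamPlaqBase`, directions j < μ
(corners z, z + e_j, z + e_μ, z + e_j + e_μ).  Every plaquette of Z^d with a corner in Λ is among them
(`mem_lamPlaqBase_of_corner`), and around every other plaquette a configuration vanishing off the bonds of Λ has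
zero circulation (`curl_eq_zero_off`): the sum of |(∂₁B)(p)|² over `lamPlaq` is the printed *"Σ_p |(∂₁B)(p)|²"*
over all plaquettes once *"B = 0 outside Λ"*. [cite: Balaban1984PropagatorsII, Lemma 2.4 (2.128) p.245] -/
def lamPlaq (L : ℕ) (Λ' : Finset (Fin d → ℤ)) : Finset ((Fin d → ℤ) × Fin d × Fin d) :=
  (lamPlaqBase L Λ' ×ˢ ((univ : Finset (Fin d)) ×ˢ (univ : Finset (Fin d)))).filter fun p => p.2.1 < p.2.2

/-- Membership in the plaquettes near Λ, coordinate form. [folklore] -/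
theorem mem_lamPlaq {Λ' : Finset (Fin d → ℤ)} {p : (Fin d → ℤ) × Fin d × Fin d} :
    p ∈ lamPlaq L Λ' ↔ p.1 ∈ lamPlaqBase L Λ' ∧ p.2.1 < p.2.2 := by
  simp only [lamPlaq, mem_filter, mem_product, mem_univ, and_true]

/-- If a point c with every coordinate in {z_i, z_i + 1} (a corner of a unit cell at z) lies in Λ, then z is in
the plaquette base. [folklore] -/
theorem mem_lamPlaqBase_of_corner {Λ' : Finset (Fin d → ℤ)} {z c : Fin d → ℤ}
    (hc : ∀ i, c i = z i ∨ c i = z i + 1) (h : c ∈ lam L Λ') : z ∈ lamPlaqBase L Λ' := by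
  obtain ⟨y, hy, hcy⟩ := mem_lam.1 h
  unfold lamPlaqBase
  refine mem_biUnion.2 ⟨y, hy, Fintype.mem_piFinset.2 fun i => mem_Ico.2 ?_⟩
  have h1 := mem_block.1 hcy i
  rcases hc i with h2 | h2 <;> constructor <;> omega

/-- Coordinates of z + e_ν are z_i or z_i + 1. [folklore] -/
theorem add_unitVec_corner (z : Fin d → ℤ) (ν : Fin d) (i : Fin d) :
    (z + unitVec ν) i = z i ∨ (z + unitVec ν) i = z i + 1 := by
  rw [add_unitVec_apply]
  split_ifs <;> omega

/-- Coordinates of z + e_ν + e_ν′ (ν ≠ ν′) are z_i or z_i + 1. [folklore] -/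
theorem add_unitVec_add_unitVec_corner (z : Fin d → ℤ) {ν ν' : Fin d} (hν : ν ≠ ν') (i : Fin d) :
    (z + unitVec ν + unitVec ν') i = z i ∨ (z + unitVec ν + unitVec ν') i = z i + 1 := by
  rw [add_unitVec_apply, add_unitVec_apply]
  split_ifs with h1 h2
  · exact absurd (h1.symm.trans h2) hν
  · omega
  · omega
  · omega

/-- **B = 0 outside Λ makes every far plaquette flat**: if B vanishes on every bond not meeting Λ, then
(∂₁B)(p) = 0 for every plaquette p = (z, j, μ), j ≠ μ, whose lowest corner is outside the plaquette base — so
`Σ_{p ∈ lamPlaq} |(∂₁B)(p)|²` equals the printed sum over ALL plaquettes. [folklore] -/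
theorem curl_eq_zero_off {Λ' : Finset (Fin d → ℤ)} {B : Cfg d} (hB : ∀ b, b ∉ lamBonds L Λ' → B b = 0)
    {z : Fin d → ℤ} {j μ : Fin d} (hjμ : j ≠ μ) (hz : z ∉ lamPlaqBase L Λ') : curl B z j μ = 0 := by
  have hoff : ∀ c : Fin d → ℤ, (∀ i, c i = z i ∨ c i = z i + 1) → c ∉ lam L Λ' :=
    fun c hc h => hz (mem_lamPlaqBase_of_corner hc h)
  have hb : ∀ (c : Fin d → ℤ) (ν : Fin d), (∀ i, c i = z i ∨ c i = z i + 1) →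
      (∀ i, (c + unitVec ν) i = z i ∨ (c + unitVec ν) i = z i + 1) → B (c, ν) = 0 :=
    fun c ν hc hc' => hB _ fun h => by
      rcases mem_lamBonds.1 h with h | h
      · exact hoff c hc h
      · exact hoff _ hc' h
  have h0 : ∀ i, z i = z i ∨ z i = z i + 1 := fun i => Or.inl rfl
  unfold curl
  rw [hb z j h0 (add_unitVec_corner z j), hb z μ h0 (add_unitVec_corner z μ),
    hb (z + unitVec j) μ (add_unitVec_corner z j) (add_unitVec_add_unitVec_corner z hjμ),
    hb (z + unitVec μ) j (add_unitVec_corner z μ) (add_unitVec_add_unitVec_corner z (Ne.symm hjμ))]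
  ring

/-! ## §2  Disjoint blocks; the in-block sums are parts of ‖B‖² and Σ_p|∂₁B|² -/

/-- Blocks at two L-lattice points sharing a point coincide (B5 (1.6): the blocks B(y), y ∈ LZ^d, tile Z^d).
[folklore] -/
theorem eq_of_mem_block (hL : 0 < L) {y y' x : Fin d → ℤ} (hy : ∀ i, (L : ℤ) ∣ y i)
    (hy' : ∀ i, (L : ℤ) ∣ y' i) (hx : x ∈ block L y) (hx' : x ∈ block L y') : y = y' := by
  have key : ∀ {w : Fin d → ℤ}, (∀ i, (L : ℤ) ∣ w i) → x ∈ block L w → corner L x = w := by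
    intro w hw hxw
    have e : corner L w = w := corner_eq_self_of_dvd w hw
    have h := (mem_block_corner_iff hL (x := x) (k := w)).1 (by rw [e]; exact hxw)
    rw [e] at h
    exact h
  exact (key hy hx).symm.trans (key hy' hx')

/-- N_in(B) := Σ_{y∈Λ′} Σ_{b⊂B(y)} |B(b)|² — the literal block sums of (2.123) (`B6TreeGaugePoincare.innerBonds`).
[cite: Balaban1984PropagatorsII, (2.123) p.244] -/
def nIn (L : ℕ) (Λ' : Finset (Fin d → ℤ)) (B : Cfg d) : ℝ := ∑ y ∈ Λ', ∑ b ∈ innerBonds L y, B b ^ 2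

/-- P_in(B) := Σ_{y∈Λ′} Σ_{p⊂B(y)} |(∂₁B)(p)|² — the literal block sums of (2.123) (`B6TreeGaugePoincare.innerPlaq`,
`curl`). [cite: Balaban1984PropagatorsII, (2.123) p.244] -/
def pIn (L : ℕ) (Λ' : Finset (Fin d → ℤ)) (B : Cfg d) : ℝ :=
  ∑ y ∈ Λ', ∑ p ∈ innerPlaq L y, curl B p.1 p.2.1 p.2.2 ^ 2

/-- ‖B‖² := Σ_{b ∈ bonds of Λ} |B(b)|². [cite: Balaban1984PropagatorsII, Lemma 2.4 (2.128) p.245] -/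
def normSq (L : ℕ) (Λ' : Finset (Fin d → ℤ)) (B : Cfg d) : ℝ := ∑ b ∈ lamBonds L Λ', B b ^ 2

/-- Σ_p |(∂₁B)(p)|² := the sum over the plaquettes near Λ (= over all plaquettes when B = 0 outside Λ,
`curl_eq_zero_off`). [cite: Balaban1984PropagatorsII, Lemma 2.4 (2.128) p.245] -/
def d1Sq (L : ℕ) (Λ' : Finset (Fin d → ℤ)) (B : Cfg d) : ℝ :=
  ∑ p ∈ lamPlaq L Λ', curl B p.1 p.2.1 p.2.2 ^ 2

/-- The inner bonds of distinct blocks of Λ are disjoint (Λ′ ⊂ LZ^d). [folklore] -/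
theorem pairwiseDisjoint_innerBonds (hL : 0 < L) {Λ' : Finset (Fin d → ℤ)}
    (hΛ : ∀ y ∈ Λ', ∀ i, (L : ℤ) ∣ y i) : (Λ' : Set (Fin d → ℤ)).PairwiseDisjoint (innerBonds L) := by
  intro y hy y' hy' hne
  rw [Function.onFun, Finset.disjoint_left]
  intro b hb hb'
  exact hne (eq_of_mem_block hL (hΛ y hy) (hΛ y' hy') (mem_innerBonds.1 hb).1 (mem_innerBonds.1 hb').1)

/-- The inner plaquettes of distinct blocks of Λ are disjoint (Λ′ ⊂ LZ^d). [folklore] -/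
theorem pairwiseDisjoint_innerPlaq (hL : 0 < L) {Λ' : Finset (Fin d → ℤ)}
    (hΛ : ∀ y ∈ Λ', ∀ i, (L : ℤ) ∣ y i) : (Λ' : Set (Fin d → ℤ)).PairwiseDisjoint (innerPlaq L) := by
  intro y hy y' hy' hne
  rw [Function.onFun, Finset.disjoint_left]
  intro p hp hp'
  exact hne (eq_of_mem_block hL (hΛ y hy) (hΛ y' hy') (mem_innerPlaq.1 hp).1 (mem_innerPlaq.1 hp').1)

/-- N_in ≤ ‖B‖²: the inner bonds of the blocks of Λ are (disjointly) among the bonds of Λ. [folklore] -/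
theorem nIn_le_normSq (hL : 0 < L) {Λ' : Finset (Fin d → ℤ)} (hΛ : ∀ y ∈ Λ', ∀ i, (L : ℤ) ∣ y i)
    (B : Cfg d) : nIn L Λ' B ≤ normSq L Λ' B := by
  unfold nIn normSq
  rw [← Finset.sum_biUnion (pairwiseDisjoint_innerBonds hL hΛ)]
  refine Finset.sum_le_sum_of_subset_of_nonneg (fun b hb => ?_) fun b _ _ => sq_nonneg _
  obtain ⟨y, hy, hby⟩ := mem_biUnion.1 hb
  exact mem_lamBonds.2 (Or.inl (mem_lam.2 ⟨y, hy, (mem_innerBonds.1 hby).1⟩))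

/-- P_in ≤ Σ_p|(∂₁B)(p)|²: the inner plaquettes of the blocks of Λ are (disjointly) among the plaquettes near Λ.
[folklore] -/
theorem pIn_le_d1Sq (hL : 0 < L) {Λ' : Finset (Fin d → ℤ)} (hΛ : ∀ y ∈ Λ', ∀ i, (L : ℤ) ∣ y i)
    (B : Cfg d) : pIn L Λ' B ≤ d1Sq L Λ' B := by
  unfold pIn d1Sq
  rw [← Finset.sum_biUnion (pairwiseDisjoint_innerPlaq hL hΛ)]
  refine Finset.sum_le_sum_of_subset_of_nonneg (fun p hp => ?_) fun p _ _ => sq_nonneg _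
  obtain ⟨y, hy, hpy⟩ := mem_biUnion.1 hp
  have h := mem_innerPlaq.1 hpy
  exact mem_lamPlaq.2
    ⟨mem_lamPlaqBase_of_corner (fun i => Or.inl rfl) (mem_lam.2 ⟨y, hy, h.1⟩), h.2.1⟩

/-! ## §3  The concrete carrier of Lemma 2.4 as `B6.TreeData` + `B6.SplitData` -/

/-- **The concrete carrier of Lemma 2.4** for the region Λ = B(Λ′) with Q₁-term `q1`: configurations = real
functions on the unit bonds of Z^d; TreeGauge B = (*"We put B = 0 outside Λ"*: B(b) = 0 for every bond not
meeting Λ) ∧ ((2.121) *"B(b) = 0 for b ⊂ Γ_{y,x}, x ∈ B(y), y ∈ Λ′"*: B(b) = 0 on the tree bonds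
`B6BondElimination.treeBonds L y` of every block); q1Sq = `q1` (parameter, e.g. `q1Of L Λ′` of §5); d1Sq =
Σ_{p near Λ}|(∂₁B)(p)|²; normSq = ‖B‖² = Σ_{b ∈ bonds of Λ}|B(b)|².
[cite: Balaban1984PropagatorsII, Lemma 2.4 p.245 with (2.121) p.244; dictionary] -/
def carrier (L : ℕ) (Λ' : Finset (Fin d → ℤ)) (q1 : Cfg d → ℝ) : TreeData where
  Cfg := Cfg d
  TreeGauge := fun B => (∀ b, b ∉ lamBonds L Λ' → B b = 0) ∧ ∀ y ∈ Λ', ∀ b ∈ treeBonds L y, B b = 0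
  q1Sq := q1
  d1Sq := d1Sq L Λ'
  normSq := normSq L Λ'

/-- **The concrete split** of the carrier: N_in, P_in = the block sums of (2.123); N_cr := ‖B‖² − N_in (the bonds
of Λ joining two blocks or leaving Λ), P_cr := Σ_p|∂₁B|² − P_in (all plaquettes near Λ not inside one block — a
superset of the printed families p ⊂ B(c) of (2.124)); all parts ≥ 0 by `nIn_le_normSq` / `pIn_le_d1Sq`
(Λ′ ⊂ LZ^d) and q1 ≥ 0 by hypothesis. [cite: Balaban1984PropagatorsII, (2.123)–(2.127) pp.244–245; dictionary] -/
def split (hL : 0 < L) {Λ' : Finset (Fin d → ℤ)} (hΛ : ∀ y ∈ Λ', ∀ i, (L : ℤ) ∣ y i) (q1 : Cfg d → ℝ)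
    (hq : ∀ B, 0 ≤ q1 B) : SplitData (carrier L Λ' q1) where
  nIn := nIn L Λ'
  nCr := fun B => normSq L Λ' B - nIn L Λ' B
  pIn := pIn L Λ'
  pCr := fun B => d1Sq L Λ' B - pIn L Λ' B
  norm_split := fun B => by
    show normSq L Λ' B = nIn L Λ' B + (normSq L Λ' B - nIn L Λ' B)
    ring
  d1_split := fun B => by
    show pIn L Λ' B + (d1Sq L Λ' B - pIn L Λ' B) ≤ d1Sq L Λ' B
    exact le_of_eq (by ring)
  nIn_nonneg := fun B => Finset.sum_nonneg fun _ _ => Finset.sum_nonneg fun _ _ => sq_nonneg _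
  nCr_nonneg := fun B => sub_nonneg.2 (nIn_le_normSq hL hΛ B)
  pIn_nonneg := fun B => Finset.sum_nonneg fun _ _ => Finset.sum_nonneg fun _ _ => sq_nonneg _
  pCr_nonneg := fun B => sub_nonneg.2 (pIn_le_d1Sq hL hΛ B)
  q1_nonneg := hq

/-! ## §4  (2.123) discharged: `Step2123` is a theorem for the carrier; Lemma 2.4_κ from (2.127)_κ alone -/

/-- **`B6.Step2123` HOLDS for the concrete carrier** (L ≥ 1, Λ′ ⊂ LZ^d, any q1 ≥ 0): the summed (2.123)
L^{−d}N_in ≤ d·P_in under the tree gauge — one line from the kernel proof of (2.123),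
`B6TreeGaugePoincare.ineq2123_rescaled`. [cite: Balaban1984PropagatorsII, (2.123) p.244; proved] -/
theorem step2123 (hL : 1 ≤ L) {Λ' : Finset (Fin d → ℤ)} (hΛ : ∀ y ∈ Λ', ∀ i, (L : ℤ) ∣ y i)
    (q1 : Cfg d → ℝ) (hq : ∀ B, 0 ≤ q1 B) :
    Step2123 d (L : ℝ) (carrier L Λ' q1) (split (Nat.lt_of_lt_of_le Nat.zero_lt_one hL) hΛ q1 hq) := by
  intro B hB
  show ((L : ℝ)⁻¹) ^ d * nIn L Λ' B ≤ (d : ℝ) * pIn L Λ' B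
  exact ineq2123_rescaled hL Λ' B hB.2

/-- **Lemma 2.4_κ for a family of concrete carriers from (2.127)_κ ALONE.**  For any index type I, regions
Λ′_i ⊂ LZ^d, Q₁-terms q1_i ≥ 0, d ≥ 2, L ≥ 1, κ ≤ 1: if the summed (2.127)_κ step `B6.Step2127` holds for every
member, then `B6.Lemma24K d L κ` holds for the family — the (2.123) slot of `B6.lemma24K_of_steps` being filled by
`step2123`.  (κ = 1 would be the printed Lemma 2.4, `B6.lemma24K_one_iff`; the printed (2.127) is false for L ≥ 10.)
[cite: Balaban1984PropagatorsII, Lemma 2.4 (2.128) p.245; assembly proved, (2.127)_κ hypothesis] -/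
theorem lemma24K_of_step2127 {I : Type} (hd : 2 ≤ d) (hL : 1 ≤ L) {κ : ℝ} (hκ : κ ≤ 1)
    (Λ' : I → Finset (Fin d → ℤ)) (hΛ : ∀ i, ∀ y ∈ Λ' i, ∀ j, (L : ℤ) ∣ y j)
    (q1 : I → Cfg d → ℝ) (hq : ∀ i B, 0 ≤ q1 i B)
    (h2127 : ∀ i, Step2127 d (L : ℝ) κ (carrier L (Λ' i) (q1 i))
      (split (Nat.lt_of_lt_of_le Nat.zero_lt_one hL) (hΛ i) (q1 i) (hq i))) :
    Lemma24K d (L : ℝ) κ (fun i => carrier L (Λ' i) (q1 i)) :=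
  lemma24K_of_steps d (L : ℝ) κ hd (Nat.one_le_cast.mpr hL) hκ (fun i => carrier L (Λ' i) (q1 i))
    (fun i => split (Nat.lt_of_lt_of_le Nat.zero_lt_one hL) (hΛ i) (q1 i) (hq i))
    (fun i => step2123 hL (hΛ i) (q1 i) (hq i)) h2127

/-- **Lemma 2.4′ (κ = κ_L) for a family of concrete carriers from (2.127)_{κ_L} alone** (d ≥ 2, L ≥ 1).
[cite: Balaban1984PropagatorsII, Lemma 2.4 (2.128) p.245; assembly proved, (2.127)_{κ_L} hypothesis] -/
theorem lemma24Repaired_of_step2127 {I : Type} (hd : 2 ≤ d) (hL : 1 ≤ L)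
    (Λ' : I → Finset (Fin d → ℤ)) (hΛ : ∀ i, ∀ y ∈ Λ' i, ∀ j, (L : ℤ) ∣ y j)
    (q1 : I → Cfg d → ℝ) (hq : ∀ i B, 0 ≤ q1 i B)
    (h2127 : ∀ i, Step2127 d (L : ℝ) (kappaL L) (carrier L (Λ' i) (q1 i))
      (split (Nat.lt_of_lt_of_le Nat.zero_lt_one hL) (hΛ i) (q1 i) (hq i))) :
    Lemma24Repaired d L (fun i => carrier L (Λ' i) (q1 i)) :=
  lemma24K_of_step2127 hd hL (kappaL_le_one L) Λ' hΛ q1 hq h2127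

/-! ## §5  The printed Q₁-term (2.125) as an instance of the parameter -/

/-- The coarse bonds c = ⟨y, y + Le_μ⟩ meeting Λ′ (at least one end point in Λ′ — the bond convention of the Lemma
read for Λ′), encoded (y, μ) = (c₋, direction). [cite: Balaban1984PropagatorsII, Lemma 2.4 p.245; dictionary] -/
def coarseBonds (L : ℕ) (Λ' : Finset (Fin d → ℤ)) : Finset ((Fin d → ℤ) × Fin d) :=
  (Λ' ×ˢ (univ : Finset (Fin d))) ∪
    ((Λ' ×ˢ (univ : Finset (Fin d))).image fun c => (c.1 - (L : ℤ) • unitVec c.2, c.2))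

/-- (2.125), first equality (p. 245, verbatim): *"|(Q₁B)(c)|² = |Σ_{x∈B(c₋)} L^{−(d+1)}B([x, x + Le_μ])|²"*, with
B([x, x + Le_μ]) = Σ_{t=0}^{L−1} B(⟨x + te_μ, x + (t+1)e_μ⟩) the sum along the straight contour, for the coarse bond
c = ⟨c₋, c₋ + Le_μ⟩ encoded (c₋, μ).  A transcription; that this is B5 (1.8)'s Q₁ under (2.121) is not asserted.
[cite: Balaban1984PropagatorsII, (2.125) p.245; dictionary] -/
def q1Term (L : ℕ) (B : Cfg d) (c : (Fin d → ℤ) × Fin d) : ℝ :=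
  (∑ x ∈ block L c.1, ((L : ℝ)⁻¹) ^ (d + 1) * ∑ t ∈ range L, B (x + (t : ℤ) • unitVec c.2, c.2)) ^ 2

/-- Σ_{c∈Λ′} |(Q₁B)(c)|² with the printed (2.125) expression for |(Q₁B)(c)|² — an admissible value of the parameter
`q1` of `carrier` (`q1Of_nonneg`). [cite: Balaban1984PropagatorsII, (2.125) + (2.128) p.245; dictionary] -/
def q1Of (L : ℕ) (Λ' : Finset (Fin d → ℤ)) (B : Cfg d) : ℝ := ∑ c ∈ coarseBonds L Λ', q1Term L B c

/-- The printed Q₁-term is ≥ 0. [folklore] -/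
theorem q1Of_nonneg (Λ' : Finset (Fin d → ℤ)) (B : Cfg d) : 0 ≤ q1Of L Λ' B :=
  Finset.sum_nonneg fun _ _ => sq_nonneg _

/-- The carrier with the printed Q₁-term satisfies `Step2123` (an instance of `step2123`). [folklore] -/
theorem step2123_q1Of (hL : 1 ≤ L) {Λ' : Finset (Fin d → ℤ)} (hΛ : ∀ y ∈ Λ', ∀ i, (L : ℤ) ∣ y i) :
    Step2123 d (L : ℝ) (carrier L Λ' (q1Of L Λ'))
      (split (Nat.lt_of_lt_of_le Nat.zero_lt_one hL) hΛ (q1Of L Λ') (q1Of_nonneg Λ')) :=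
  step2123 hL hΛ (q1Of L Λ') (q1Of_nonneg Λ')

end

end Literature.MathematicalPhysics.QuantumFieldTheory.Balaban1983to89.B6Lemma24Carrier
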